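import Summits.ABC.ABC.Theses.DefiniteXi
import HarnessLib

/-!
# Stub-ideation k3 · gen 10 — `stub_primeToSixDegreeBound` (P6), crux `DefiniteXi.SteinbergCore` (stmt-ABC-15024)

Currency sketch over the ROUTE FILE ALONE (no `Theorems/DefiniteXiSteinbergCore*` import, whose oleans were stale on the
check farm on 2026-08-31): the stub verbatim (`Stub`), the only implication INTO it (`stub_of_freyDegreeBound`, = tree
`SteinbergCorePrimeRung.primeToSixDegreeBound_of_freyDegreeBound`, p162616), and the exponent-monotone form used by the
Family-3 ladder (`stub_mono`: a bound with exponent `2 + ε₀` serves every `ε ≥ ε₀`).  No sorry.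
-/

set_option linter.dupNamespace false

namespace Summit.ABC.ABC.Cruxes.SteinbergCore.StubIdeas3G10

open Summit.ABC.ABC.Theses.DefiniteXi
open Literature.NumberTheory.EllipticCurves Literature.NumberTheory.EllipticCurves.ModularForms

/-- The registered stub `stub_primeToSixDegreeBound`, verbatim. [folklore] -/
def Stub : Prop :=
  ∀ ε : ℝ, 0 < ε → ∃ C : ℝ, ∀ a b : ℤ, IsCoprime a b → a * b * (a + b) ≠ 0 → ∀ (N : ℕ) [NeZero N],
    (Literature.NumberTheory.EllipticCurves.freyCurve a b).conductorNorm ℤ = N →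
    ∀ D : Literature.NumberTheory.EllipticCurves.ModularForms.ModularParametrizationData
      (Literature.NumberTheory.EllipticCurves.freyCurve a b) N,
      (∀ D' : Literature.NumberTheory.EllipticCurves.ModularForms.ModularParametrizationData
        (Literature.NumberTheory.EllipticCurves.freyCurve a b) N, D.deg ≤ D'.deg) →
      ((D.deg / (ordProj[2] D.deg * ordProj[3] D.deg) : ℕ) : ℝ) ≤ C * (N : ℝ) ^ (2 + ε)

/-- `cps n ≤ n` in `ℝ`. [folklore] -/
theorem cps_cast_le (n : ℕ) : ((n / (ordProj[2] n * ordProj[3] n) : ℕ) : ℝ) ≤ (n : ℝ) := by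
  exact_mod_cast Nat.div_le_self _ _

/-- **H0 over the route file alone**: the route TARGET `FreyDegreeBound` gives the stub (a minimal datum has degree at
most that of the datum the target provides; then `cps n ≤ n`). [folklore] -/
theorem stub_of_freyDegreeBound (hX : FreyDegreeBound) : Stub := by
  intro ε hε
  obtain ⟨C, hC⟩ := hX ε hε
  refine ⟨C, fun a b hab h0 N _ hN D hDmin => ?_⟩
  obtain ⟨D₀, hD₀⟩ := hC a b hab h0 N hN
  have h2 : (D.deg : ℝ) ≤ (D₀.deg : ℝ) := by exact_mod_cast hDmin D₀
  exact (cps_cast_le D.deg).trans (h2.trans hD₀)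

/-- The pointwise inequality at one exponent serves every larger exponent (`1 ≤ N`). [folklore] -/
theorem rpow_exponent_mono {N : ℕ} [NeZero N] {C s t : ℝ} (hC : 0 ≤ C) (hst : s ≤ t) :
    C * (N : ℝ) ^ s ≤ C * (N : ℝ) ^ t := by
  have hN : (1 : ℝ) ≤ (N : ℝ) := by exact_mod_cast Nat.one_le_iff_ne_zero.mpr (NeZero.ne N)
  exact mul_le_mul_of_nonneg_left (Real.rpow_le_rpow_of_exponent_le hN hst) hC

/-- **Exponent-ladder form** (Family 3, autopsy of the `ε`-guard): it suffices to prove the stub's inequality for all SMALL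
`ε` — precisely, a witness `C ≥ 0` at exponent `2 + ε₀` is a witness at every `2 + ε`, `ε ≥ ε₀`. [folklore] -/
theorem stub_of_small_eps
    (h : ∀ ε : ℝ, 0 < ε → ε ≤ 1 → ∃ C : ℝ, 0 ≤ C ∧ ∀ a b : ℤ, IsCoprime a b → a * b * (a + b) ≠ 0 → ∀ (N : ℕ) [NeZero N],
      (Literature.NumberTheory.EllipticCurves.freyCurve a b).conductorNorm ℤ = N →
      ∀ D : Literature.NumberTheory.EllipticCurves.ModularForms.ModularParametrizationData
        (Literature.NumberTheory.EllipticCurves.freyCurve a b) N,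
        (∀ D' : Literature.NumberTheory.EllipticCurves.ModularForms.ModularParametrizationData
          (Literature.NumberTheory.EllipticCurves.freyCurve a b) N, D.deg ≤ D'.deg) →
        ((D.deg / (ordProj[2] D.deg * ordProj[3] D.deg) : ℕ) : ℝ) ≤ C * (N : ℝ) ^ (2 + ε)) :
    Stub := by
  intro ε hε
  obtain ⟨C, hC0, hC⟩ := h (min ε 1) (lt_min hε one_pos) (min_le_right _ _)
  refine ⟨C, fun a b hab h0 N _ hN D hDmin => ?_⟩
  have h1 := hC a b hab h0 N hN D hDmin
  exact h1.trans (rpow_exponent_mono hC0 (by linarith [min_le_left ε 1]))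

end Summit.ABC.ABC.Cruxes.SteinbergCore.StubIdeas3G10
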